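/-
Copyright (c) 2026. All rights reserved.
Released under Apache 2.0 license as described in the file LICENSE.
-/
import Mathlib
import HarnessLib
import Summits.RiemannHypothesis.RiemannHypothesis.Theorems.EarlyAppointmentsExistsNonzero

/-!
# Sequence converging to a simple zero with f ≠ 0

This file constructs a sequence z_n → c with f(z_n) ≠ 0 and z_n ≠ c.
This is used in the G decomposition limit argument for CombDescentStep.
-/

open Complex Real Set Filter Topology Metric
open scoped BigOperators Topology ComplexConjugate

noncomputable section

namespace EarlyAppointmentsNonzeroSeq

/-- Sequence converging to c with f ≠ 0 and z ≠ c. -/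
def nonzero_seq (f : ℂ → ℂ) (c : ℂ) (hf_diff : Differentiable ℂ f)
    (hz : f c = 0) (hz_simple : deriv f c ≠ 0) (n : ℕ) : ℂ :=
  (EarlyAppointmentsExistsNonzero.exists_nonzero_near_simple_zero hf_diff hz hz_simple
    (1 / (n + 1 : ℝ)) (by positivity)).choose

/-- The sequence elements are distinct from c. -/
theorem nonzero_seq_ne (f : ℂ → ℂ) (c : ℂ) (hf_diff : Differentiable ℂ f)
    (hz : f c = 0) (hz_simple : deriv f c ≠ 0) (n : ℕ) :
    nonzero_seq f c hf_diff hz hz_simple n ≠ c :=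
  ((EarlyAppointmentsExistsNonzero.exists_nonzero_near_simple_zero hf_diff hz hz_simple
    (1 / (n + 1 : ℝ)) (by positivity)).choose_spec).1

/-- The sequence elements are within distance 1/(n+1) of c. -/
theorem nonzero_seq_dist (f : ℂ → ℂ) (c : ℂ) (hf_diff : Differentiable ℂ f)
    (hz : f c = 0) (hz_simple : deriv f c ≠ 0) (n : ℕ) :
    ‖nonzero_seq f c hf_diff hz hz_simple n - c‖ < 1 / (n + 1 : ℝ) :=
  ((EarlyAppointmentsExistsNonzero.exists_nonzero_near_simple_zero hf_diff hz hz_simple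
    (1 / (n + 1 : ℝ)) (by positivity)).choose_spec).2.1

/-- f is nonzero at each sequence element. -/
theorem nonzero_seq_f_ne (f : ℂ → ℂ) (c : ℂ) (hf_diff : Differentiable ℂ f)
    (hz : f c = 0) (hz_simple : deriv f c ≠ 0) (n : ℕ) :
    f (nonzero_seq f c hf_diff hz hz_simple n) ≠ 0 :=
  ((EarlyAppointmentsExistsNonzero.exists_nonzero_near_simple_zero hf_diff hz hz_simple
    (1 / (n + 1 : ℝ)) (by positivity)).choose_spec).2.2

/-- The nonzero sequence converges to c. -/
theorem nonzero_seq_tendsto (f : ℂ → ℂ) (c : ℂ) (hf_diff : Differentiable ℂ f)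
    (hz : f c = 0) (hz_simple : deriv f c ≠ 0) :
    Tendsto (nonzero_seq f c hf_diff hz hz_simple) atTop (nhds c) := by
  rw [Metric.tendsto_atTop]
  intro ε hε
  obtain ⟨N, hN⟩ := exists_nat_gt (1 / ε)
  use N
  intro n hn
  have h1 : 1 / (n + 1 : ℝ) < ε := by
    have hn1 : (N : ℝ) < n + 1 := by
      calc (N : ℝ) ≤ n := Nat.cast_le.mpr hn
        _ < n + 1 := by linarith
    have h2 : 1 / ε < n + 1 := lt_trans hN hn1
    have hn1_pos : (0 : ℝ) < n + 1 := by linarith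
    rw [div_lt_iff₀ hn1_pos]
    rw [div_lt_iff₀ hε] at h2
    have h3 : 1 < ε * (n + 1) := by linarith
    linarith
  calc dist (nonzero_seq f c hf_diff hz hz_simple n) c
      = ‖nonzero_seq f c hf_diff hz hz_simple n - c‖ := dist_eq_norm _ _
    _ < 1 / (n + 1 : ℝ) := nonzero_seq_dist f c hf_diff hz hz_simple n
    _ < ε := h1

end EarlyAppointmentsNonzeroSeq

end
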